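import Literature.NumberTheory.Sieve.MoebiusShiftedPrimesDecomposition
import Literature.NumberTheory.Sieve.MoebiusShiftedPrimesTypical
import HarnessLib

/-!
# Möbius on shifted primes — Theorem 1.1 (power range) from Theorem 2.2 along the corrected sets `S_c`

Topic `Literature/NumberTheory/Sieve`.  Everything in this file is PROVED; it has no definitions and
introduces no named fact.  Its result,

* `lichtman2020_moebius_shifted_primes_avg_power_of_keyFourierEstimateWith :
    Lichtman2020_keyFourierEstimateWith → lichtman2020_moebius_shifted_primes_avg_power`,

is the power-range part of J. D. Lichtman, *Averages of the Möbius function on shifted primes*, Quart.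
J. Math. 73 (2022) 729–757 (doi:10.1093/qmath/haab054, arXiv:2009.08969v2), Theorem 1.1 (the named
fact `Literature.NumberTheory.Sieve.lichtman2020_moebius_shifted_primes_avg_power`), deduced from the
key Fourier estimate along the CORRECTED typical sets `S_c = lichtmanTypicalWith c`
(`Lichtman2020_keyFourierEstimateWith`, `MoebiusShiftedPrimesTypical.lean`: the first interval of `S`
is `[(log X)^{cA}, H/(log X)^{4A}]` with `c ≥ 100` instead of the printed `33`, because the printed
proof of Proposition 5.1 loses a factor `V²` — see the module docstring of that file).  It is the
companion of `MoebiusShiftedPrimesDecomposition.lean`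
(`lichtman2020_moebius_shifted_primes_avg_power_of_keyFourierEstimate`, the same deduction from the
printed Theorem 2.2), whose argument and lemmas are reused verbatim with `c = 100`, `A = 10`,
`δ' = δ/2`: only the sieve side changes (`P₁ = (log N)^{1000}`, so `log P₁/log Q₁ ≤ 4000 ℓ/y^{2/3}`
with `y = log X`, `ℓ = log log X`, again absorbed by the `δ` in the exponent `1/3 - δ`).

## References

* J. D. Lichtman, arXiv:2009.08969v2: Thm 1.1 (PDF p. 3), §2: Lemma 2.1, (2.3)–(2.6), Thm 2.2
  (PDF pp. 7–8) [Lichtman2020].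
-/

open Filter Asymptotics Finset MeasureTheory
open scoped Topology

namespace Literature.NumberTheory.Sieve.Lichtman2020

/-! ### The exceptional (sieve) side at a fixed `X`, along `S_{100}` -/

/-- **Exceptional (sieve) side of the proof of Theorem 1.1 (power range)** at a fixed `X`, along
`S_c` with `c = 100` (a copy of `sum_card_exceptional_le` with `P₁ = (log N)^{1000}`): for
`S = S_{100}(N, 10, δ')` built at a scale `N` with `log X ≤ log N ≤ 2 log X` and the capped window `Hp`
(`exp((log N)^{2/3})/2 ≤ Hp ≤ exp((log N)^{2/3})`), the sieve bound (hypothesis `hsv`, the weak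
form of (2.5) at `X`) applied to the two intervals `[P₁, Q₁] = [(log N)^{1000}, Hp (log N)^{-40}]`
and `[P₂, Q₂] = [exp((log N)^{2/3+δ'/2}), exp((log N)^{1-δ'/2})]` gives, under numerical
conditions that hold for all large `X`,
`∑_{h ≤ H} #{p ≤ X : p + h ∉ S} ≤ H · Cs (X ℓ/y) (4000 ℓ/y^{2/3} + y^{δ'-1/3})`
(`y = log X`, `ℓ = log log X`). [cite: Lichtman2020, §2, proof of Thm 1.1 (displays (2.5)–(2.6))] -/
theorem sum_card_exceptional_le_with {X H N : ℕ} {δ' Cs Hp : ℝ} (hCs : 0 ≤ Cs) (hδ0 : 0 < δ')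
    (hδ3 : δ' ≤ 1 / 3) (hHX : H ≤ X)
    (hy1 : 1 ≤ Real.log X) (hll1 : 1 ≤ Real.log (Real.log X))
    (hyN : Real.log X ≤ Real.log N) (hyN2 : Real.log N ≤ 2 * Real.log X)
    (n3 : 1040 * Real.log (Real.log N) ≤ Real.log N ^ (2 / 3 : ℝ) - Real.log 2)
    (nQ1 : Real.log N ^ (2 / 3 : ℝ) ≤ Real.log X / (40 * Real.log (Real.log X)))
    (nQ2 : Real.log N ^ (1 - δ' / 2) ≤ Real.log X / (40 * Real.log (Real.log X)))
    (n6 : Real.log (Real.log N) ≤ Real.log N ^ (2 / 3 + δ' / 2))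
    (hHplo : Real.exp (Real.log N ^ (2 / 3 : ℝ)) / 2 ≤ Hp)
    (hHphi : Hp ≤ Real.exp (Real.log N ^ (2 / 3 : ℝ)))
    (S : ℕ → Prop) [DecidablePred S]
    (hS : ∀ n, S n ↔ (HasPrimeFactorIn (Real.log N ^ (100 * 10 : ℝ)) (Hp / Real.log N ^ (4 * 10 : ℝ)) n ∧
      HasPrimeFactorIn (Real.exp (Real.log N ^ (2 / 3 + δ' / 2)))
        (Real.exp (Real.log N ^ (1 - δ' / 2))) n))
    (hsv : ∀ h : ℕ, 1 ≤ h → h ≤ X → ∀ P Q : ℝ, Real.log X ≤ P → P ≤ Q →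
      Q ≤ Real.exp (Real.log X / (40 * Real.log (Real.log X))) →
      (#{p ∈ Nat.primesLE X | ¬ HasPrimeFactorIn P Q (p + h)} : ℝ) ≤
        Cs * (X * Real.log (Real.log X) / Real.log X) * (Real.log P / Real.log Q)) :
    ∑ h ∈ Icc 1 H, (#{p ∈ Nat.primesLE X | ¬ S (p + h)} : ℝ) ≤
      H * (Cs * (X * Real.log (Real.log X) / Real.log X) *
          (4000 * Real.log (Real.log X) / Real.log X ^ (2 / 3 : ℝ)) +
        Cs * (X * Real.log (Real.log X) / Real.log X) * Real.log X ^ (δ' - 1 / 3)) := by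
  set y := Real.log (X : ℝ) with hy
  set ll := Real.log y with hll
  set yN := Real.log (N : ℝ) with hyN'
  set llN := Real.log yN with hllN
  set P₁ : ℝ := yN ^ (100 * 10 : ℝ) with hP₁
  set Q₁ : ℝ := Hp / yN ^ (4 * 10 : ℝ) with hQ₁
  set P₂ : ℝ := Real.exp (yN ^ (2 / 3 + δ' / 2)) with hP₂
  set Q₂ : ℝ := Real.exp (yN ^ (1 - δ' / 2)) with hQ₂
  have hy0 : 0 < y := by linarith
  have hll0 : 0 < ll := by linarith
  have hyN1 : 1 ≤ yN := hy1.trans hyN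
  have hyN0 : 0 < yN := by linarith
  have hlog2 : Real.log 2 < 1 := by linarith [Real.log_two_lt_d9]
  have hlog2p : 0 < Real.log 2 := Real.log_pos one_lt_two
  -- `ll ≤ llN ≤ 2 ll`
  have hllN1 : ll ≤ llN := Real.log_le_log hy0 hyN
  have hllN0 : 0 < llN := by linarith
  have hllN2 : llN ≤ 2 * ll := by
    calc llN ≤ Real.log (2 * y) := Real.log_le_log hyN0 hyN2
      _ = Real.log 2 + ll := by rw [Real.log_mul (by norm_num) hy0.ne']
      _ ≤ 2 * ll := by linarith
  set E := Real.exp (yN ^ (2 / 3 : ℝ)) with hE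
  have hE0 : 0 < E := Real.exp_pos _
  have hHp0 : 0 < Hp := lt_of_lt_of_le (by positivity) hHplo
  have hregQ : E ≤ Real.exp (y / (40 * ll)) := Real.exp_le_exp.mpr nQ1
  -- interval 1
  have hlogP1 : Real.log P₁ = 1000 * llN := by
    rw [hP₁, Real.log_rpow hyN0]; ring
  have hlogQ1 : Real.log Q₁ = Real.log Hp - 40 * llN := by
    rw [hQ₁, Real.log_div hHp0.ne' (Real.rpow_pos_of_pos hyN0 _).ne', Real.log_rpow hyN0]; ring
  have hlogHp : yN ^ (2 / 3 : ℝ) - Real.log 2 ≤ Real.log Hp := by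
    have := Real.log_le_log (by positivity) hHplo
    rwa [Real.log_div hE0.ne' (by norm_num), hE, Real.log_exp] at this
  have hQ1lo : yN ^ (2 / 3 : ℝ) / 2 ≤ Real.log Q₁ := by rw [hlogQ1]; linarith
  have hy23 : y ^ (2 / 3 : ℝ) ≤ yN ^ (2 / 3 : ℝ) := Real.rpow_le_rpow hy0.le hyN (by norm_num)
  have hy23pos : 0 < y ^ (2 / 3 : ℝ) := Real.rpow_pos_of_pos hy0 _
  have hQ1pos : 0 < Real.log Q₁ := lt_of_lt_of_le (by positivity) hQ1lo
  have hreg1a : y ≤ P₁ := by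
    rw [hP₁]
    calc y ≤ yN := hyN
      _ = yN ^ (1 : ℝ) := (Real.rpow_one yN).symm
      _ ≤ yN ^ (100 * 10 : ℝ) := Real.rpow_le_rpow_of_exponent_le hyN1 (by norm_num)
  have hreg1b : P₁ ≤ Q₁ := by
    rw [hP₁, hQ₁, le_div_iff₀ (Real.rpow_pos_of_pos hyN0 _), ← Real.rpow_add hyN0]
    calc yN ^ (100 * 10 + 4 * 10 : ℝ) = Real.exp (1040 * llN) := by
          rw [Real.rpow_def_of_pos hyN0, ← hllN]; ring_nf
      _ ≤ Real.exp (yN ^ (2 / 3 : ℝ) - Real.log 2) := Real.exp_le_exp.mpr (by linarith)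
      _ = E / 2 := by rw [Real.exp_sub, Real.exp_log two_pos]
      _ ≤ Hp := hHplo
  have hreg1c : Q₁ ≤ Real.exp (y / (40 * ll)) := by
    calc Q₁ ≤ Hp := by
          rw [hQ₁]
          exact div_le_self hHp0.le (Real.one_le_rpow hyN1 (by norm_num))
      _ ≤ E := hHphi
      _ ≤ _ := hregQ
  -- interval 2
  have hlogP2 : Real.log P₂ = yN ^ (2 / 3 + δ' / 2) := by rw [hP₂, Real.log_exp]
  have hlogQ2 : Real.log Q₂ = yN ^ (1 - δ' / 2) := by rw [hQ₂, Real.log_exp]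
  have hr2 : Real.log P₂ / Real.log Q₂ = yN ^ (δ' - 1 / 3) := by
    rw [hlogP2, hlogQ2, ← Real.rpow_sub hyN0]; ring_nf
  have hr2' : yN ^ (δ' - 1 / 3) ≤ y ^ (δ' - 1 / 3) :=
    Real.rpow_le_rpow_of_nonpos hy0 hyN (by linarith)
  have hreg2a : y ≤ P₂ := by
    rw [hP₂]
    calc y ≤ yN := hyN
      _ = Real.exp llN := by rw [hllN, Real.exp_log hyN0]
      _ ≤ Real.exp (yN ^ (2 / 3 + δ' / 2)) := Real.exp_le_exp.mpr n6
  have hreg2b : P₂ ≤ Q₂ := by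
    rw [hP₂, hQ₂]
    exact Real.exp_le_exp.mpr (Real.rpow_le_rpow_of_exponent_le hyN1 (by linarith))
  have hreg2c : Q₂ ≤ Real.exp (y / (40 * ll)) := by
    rw [hQ₂]; exact Real.exp_le_exp.mpr nQ2
  -- per-`h` bound
  have hXll : 0 ≤ Cs * (X * ll / y) := by positivity
  have key : ∀ h ∈ Icc 1 H,
      (#{p ∈ Nat.primesLE X | ¬ S (p + h)} : ℝ) ≤
        Cs * (X * ll / y) * (4000 * ll / y ^ (2 / 3 : ℝ)) +
          Cs * (X * ll / y) * y ^ (δ' - 1 / 3) := by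
    intro h hh
    rw [Finset.mem_Icc] at hh
    have hhX : h ≤ X := hh.2.trans hHX
    -- union bound
    have hsub : {p ∈ Nat.primesLE X | ¬ S (p + h)} ⊆
        {p ∈ Nat.primesLE X | ¬ HasPrimeFactorIn P₁ Q₁ (p + h)} ∪
          {p ∈ Nat.primesLE X | ¬ HasPrimeFactorIn P₂ Q₂ (p + h)} := by
      intro p hp
      rw [Finset.mem_filter] at hp
      rw [Finset.mem_union, Finset.mem_filter, Finset.mem_filter]
      by_cases h1 : HasPrimeFactorIn P₁ Q₁ (p + h)
      · by_cases h2 : HasPrimeFactorIn P₂ Q₂ (p + h)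
        · exact absurd ((hS (p + h)).mpr ⟨h1, h2⟩) hp.2
        · exact Or.inr ⟨hp.1, h2⟩
      · exact Or.inl ⟨hp.1, h1⟩
    have hcard : (#{p ∈ Nat.primesLE X | ¬ S (p + h)} : ℝ) ≤
        #{p ∈ Nat.primesLE X | ¬ HasPrimeFactorIn P₁ Q₁ (p + h)} +
          #{p ∈ Nat.primesLE X | ¬ HasPrimeFactorIn P₂ Q₂ (p + h)} := by
      exact_mod_cast (Finset.card_le_card hsub).trans (Finset.card_union_le _ _)
    have h1 := hsv h hh.1 hhX _ _ hreg1a hreg1b hreg1c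
    have h2 := hsv h hh.1 hhX _ _ hreg2a hreg2b hreg2c
    rw [hr2] at h2
    rw [hlogP1] at h1
    have h1' : (#{p ∈ Nat.primesLE X | ¬ HasPrimeFactorIn P₁ Q₁ (p + h)} : ℝ) ≤
        Cs * (X * ll / y) * (4000 * ll / y ^ (2 / 3 : ℝ)) := by
      refine h1.trans ?_
      gcongr Cs * (X * ll / y) * ?_
      rw [div_le_div_iff₀ hQ1pos hy23pos]
      calc 1000 * llN * y ^ (2 / 3 : ℝ) ≤ 1000 * (2 * ll) * yN ^ (2 / 3 : ℝ) := by gcongr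
        _ = 4000 * ll * (yN ^ (2 / 3 : ℝ) / 2) := by ring
        _ ≤ 4000 * ll * Real.log Q₁ := by gcongr
    have h2' : (#{p ∈ Nat.primesLE X | ¬ HasPrimeFactorIn P₂ Q₂ (p + h)} : ℝ) ≤
        Cs * (X * ll / y) * y ^ (δ' - 1 / 3) :=
      h2.trans (mul_le_mul_of_nonneg_left hr2' hXll)
    linarith
  calc ∑ h ∈ Icc 1 H, (#{p ∈ Nat.primesLE X | ¬ S (p + h)} : ℝ)
      ≤ ∑ h ∈ Icc 1 H, (Cs * (X * ll / y) * (4000 * ll / y ^ (2 / 3 : ℝ)) +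
          Cs * (X * ll / y) * y ^ (δ' - 1 / 3)) := Finset.sum_le_sum key
    _ = _ := by rw [Finset.sum_const, Nat.card_Icc, add_tsub_cancel_right, nsmul_eq_mul]

end Literature.NumberTheory.Sieve.Lichtman2020

namespace Literature.NumberTheory.Sieve

open Lichtman2020 in
/-- **Lichtman 2020, Theorem 1.1 (power range) from Theorem 2.2 along `S_c`, `c = 100`.** For
`H = X^θ`, `θ ∈ (0, 1)`, and every `δ > 0`, `∑_{h ≤ H} |∑_{p ≤ X} μ(p + h)| ≪_{θ,δ} H π(X)/(log X)^{1/3 - δ}`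
— the named fact `lichtman2020_moebius_shifted_primes_avg_power` of `MoebiusShiftedPrimes.lean` — from
the corrected key Fourier estimate `Lichtman2020_keyFourierEstimateWith` (Theorem 2.2 along the typical
sets `S_c` of `MoebiusShiftedPrimesTypical.lean`, applied with `c = 100`, `A = 10`, `δ' = δ/2`).  The
proof is that of `lichtman2020_moebius_shifted_primes_avg_power_of_keyFourierEstimate`
(`MoebiusShiftedPrimesDecomposition.lean`) verbatim, with `P₁ = (log N)^{1000}` in place of
`(log N)^{330}` on the sieve side (`sum_card_exceptional_le_with`: `log P₁/log Q₁ ≤ 4000 ℓ/y^{2/3}`,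
absorbed by the `δ` in the exponent as before). [cite: Lichtman2020, Theorem 1.1 and §2] -/
theorem lichtman2020_moebius_shifted_primes_avg_power_of_keyFourierEstimateWith
    (h22 : Lichtman2020_keyFourierEstimateWith) : lichtman2020_moebius_shifted_primes_avg_power := by
  -- Step 0: reduce to `δ ≤ 1/6`
  suffices main : ∀ θ : ℝ, 0 < θ → θ < 1 → ∀ δ : ℝ, 0 < δ → δ ≤ 1 / 6 →
      (fun X : ℕ => ∑ h ∈ Icc 1 ⌊(X : ℝ) ^ θ⌋₊, |moebiusShiftedPrimeSum h X|) =O[atTop]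
        fun X : ℕ => (⌊(X : ℝ) ^ θ⌋₊ : ℝ) * Nat.primeCounting X / Real.log X ^ (1 / 3 - δ) by
    intro θ hθ0 hθ1 δ hδ
    refine (main θ hθ0 hθ1 (min δ (1 / 6)) (lt_min hδ (by norm_num)) (min_le_right _ _)).trans ?_
    refine IsBigO.of_bound 1 ?_
    filter_upwards [(Real.tendsto_log_atTop.comp tendsto_natCast_atTop_atTop).eventually_ge_atTop 1]
      with X hX
    have hX' : 1 ≤ Real.log X := hX
    rw [one_mul, Real.norm_of_nonneg (by positivity), Real.norm_of_nonneg (by positivity)]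
    have hpos : 0 < Real.log X ^ (1 / 3 - δ) := Real.rpow_pos_of_pos (by linarith) _
    exact div_le_div_of_nonneg_left (by positivity) hpos
      (Real.rpow_le_rpow_of_exponent_le hX' (by linarith [min_le_left δ (1 / 6)]))
  intro θ hθ0 hθ1 δ hδ0 hδ6
  -- the weak sieve bound (2.5) of `ShiftedPrimesRoughSieve.lean` (it spells `HasPrimeFactorIn` out)
  obtain ⟨Cs, X₀, hCs⟩ := ShiftedPrimesSieve.card_primes_shift_free_le
  -- Theorem 2.2 along `N` with `A = 10`, `δ' = δ/2` and the window `cap`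
  obtain ⟨C22, hC22⟩ := h22 100 (by norm_num) 10 (by norm_num) (δ / 2) (by positivity) cap
    tendsto_log_cap_div (Eventually.of_forall fun N => cap_le N)
  have h4 : Tendsto (fun X : ℕ => 4 * X) atTop atTop :=
    tendsto_atTop_atTop.2 fun b => ⟨b, fun X hX => by omega⟩
  -- the discrete key Fourier bound at `N = 4X`
  have hT : ∀ᶠ X : ℕ in atTop, ∀ α : ℝ,
      ∑ k ∈ Icc 1 (4 * X), ‖moebiusTwistedSum ((Icc k (k + cap (4 * X) - 1)).filter
          (lichtmanTypicalWith 100 ((4 * X : ℕ) : ℝ) 10 (δ / 2) (cap (4 * X) : ℝ))) α‖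
        ≤ C22 * ((cap (4 * X) : ℝ) * ((4 * X : ℕ) : ℝ) /
            Real.log ((4 * X : ℕ) : ℝ) ^ ((10 : ℝ) / 5)) := by
    filter_upwards [h4.eventually hC22] with X hX α
    have hconv : ∫ x in (0 : ℝ)..((4 * X : ℕ) : ℝ),
        ‖moebiusTwistedSum ((Icc ⌈x⌉₊ ⌊x + (cap (4 * X) : ℝ)⌋₊).filter
          (lichtmanTypicalWith 100 ((4 * X : ℕ) : ℝ) 10 (δ / 2) (cap (4 * X) : ℝ))) α‖ =
        ∑ k ∈ Icc 1 (4 * X), ‖moebiusTwistedSum ((Icc k (k + cap (4 * X) - 1)).filter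
          (lichtmanTypicalWith 100 ((4 * X : ℕ) : ℝ) 10 (δ / 2) (cap (4 * X) : ℝ))) α‖ :=
      integral_window_eq_sum (fun s => ‖moebiusTwistedSum (s.filter
        (lichtmanTypicalWith 100 ((4 * X : ℕ) : ℝ) 10 (δ / 2) (cap (4 * X) : ℝ))) α‖)
        (4 * X) (cap (4 * X)) (one_le_cap _)
    rw [← hconv]
    exact hX α
  have hCs'0 : 0 ≤ max Cs 0 := le_max_right _ _
  have hC22'0 : 0 ≤ max C22 0 := le_max_right _ _
  have hcF0 : 0 ≤ Real.sqrt (8 * (12 * max C22 0 + 3)) := Real.sqrt_nonneg _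
  -- eventual numerical conditions, transferred from `ℝ` to `ℕ` (at scale `X` and at scale `4X`)
  have ev := fun {p : ℝ → Prop} (h : ∀ᶠ x : ℝ in atTop, p x) =>
    tendsto_natCast_atTop_atTop (R := ℝ).eventually h
  have ev4 := fun {p : ℝ → Prop} (h : ∀ᶠ x : ℝ in atTop, p x) =>
    ((tendsto_natCast_atTop_atTop (R := ℝ)).comp h4).eventually h
  have e_y1 : ∀ᶠ X : ℕ in atTop, 1 ≤ Real.log X :=
    ev (Real.tendsto_log_atTop.eventually_ge_atTop 1)
  have e_ll1 : ∀ᶠ X : ℕ in atTop, 1 ≤ Real.log (Real.log X) :=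
    ev ((Real.tendsto_log_atTop.comp Real.tendsto_log_atTop).eventually_ge_atTop 1)
  have e_n3a : ∀ᶠ X : ℕ in atTop, Real.log (Real.log ((4 * X : ℕ) : ℝ)) ≤
      1 / 2080 * Real.log ((4 * X : ℕ) : ℝ) ^ (2 / 3 : ℝ) :=
    ev4 (eventually_loglog_le _ _ (by norm_num) (by norm_num))
  have e_n3b : ∀ᶠ X : ℕ in atTop, 2 * Real.log 2 ≤ Real.log ((4 * X : ℕ) : ℝ) ^ (2 / 3 : ℝ) :=
    ev4 ((tendsto_log_rpow_atTop (by norm_num : (0:ℝ) < 2 / 3)).eventually_ge_atTop _)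
  have e_nQ1 : ∀ᶠ X : ℕ in atTop, Real.log (Real.log X) ≤ 1 / 80 * Real.log X ^ (1 / 3 : ℝ) :=
    ev (eventually_loglog_le _ _ (by norm_num) (by norm_num))
  have e_nQ2 : ∀ᶠ X : ℕ in atTop, Real.log (Real.log X) ≤ 1 / 80 * Real.log X ^ (δ / 2 / 2) :=
    ev (eventually_loglog_le _ _ (by positivity) (by norm_num))
  have e_n6 : ∀ᶠ X : ℕ in atTop, Real.log (Real.log ((4 * X : ℕ) : ℝ)) ≤
      1 * Real.log ((4 * X : ℕ) : ℝ) ^ (2 / 3 + δ / 2 / 2) :=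
    ev4 (eventually_loglog_le _ _ (by positivity) (by norm_num))
  have e_n9 : ∀ᶠ X : ℕ in atTop,
      Real.log (Real.log X) ≤ 1 / 90 * Real.log X ^ ((1 / 3 + δ) / 2) :=
    ev (eventually_loglog_le _ _ (by positivity) (by norm_num))
  have e_n10 : ∀ᶠ X : ℕ in atTop, Real.log (Real.log X) ≤ 1 / 2 * Real.log X ^ (δ / 2) :=
    ev (eventually_loglog_le _ _ (by positivity) (by norm_num))
  refine IsBigO.of_bound (Real.sqrt (8 * (12 * max C22 0 + 3)) + 2 * max Cs 0) ?_
  filter_upwards [hT, eventually_ge_atTop X₀, eventually_ge_atTop 4,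
    eventually_exp_two_rpow_le_floor hθ0, eventually_exp_two_rpow_le_div,
    eventually_primeCounting_le_two, eventually_primeCounting_ge, e_y1, e_ll1, e_n3a, e_n3b,
    e_nQ1, e_nQ2, e_n6, e_n9, e_n10]
    with X hTX hX₀ hX4 hEH hEX hπhi hπlo hy1 hll1 n3a n3b nQ1 nQ2 n6 n9 n10
  -- abbreviations
  set Cs' := max Cs 0 with hCs'
  set C22' := max C22 0 with hC22'
  set cF : ℝ := Real.sqrt (8 * (12 * C22' + 3)) with hcF
  set δ' := δ / 2 with hδ'
  set y := Real.log (X : ℝ) with hy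
  set ll := Real.log y with hll
  set N : ℕ := 4 * X with hNdef
  set yN := Real.log (N : ℝ) with hyN
  set H : ℕ := ⌊(X : ℝ) ^ θ⌋₊ with hHdef
  set Hp : ℕ := cap N with hHpdef
  set J : ℕ := 2 * H / Hp + 1 with hJdef
  set L : ℕ := J * Hp with hLdef
  set piX : ℝ := (Nat.primeCounting X : ℝ) with hpiX
  set w : ℝ := y ^ (δ - 1 / 3) with hw
  set E : ℝ := Real.exp (yN ^ (2 / 3 : ℝ)) with hEdef
  have hδ'0 : 0 < δ' := by positivity
  have hδ'3 : δ' ≤ 1 / 3 := by rw [hδ']; linarith only [hδ6]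
  have hy0 : 0 < y := by linarith only [hy1]
  have hll0 : 0 < ll := by linarith only [hll1]
  have hX0 : (0 : ℝ) < X := by exact_mod_cast (by omega : 0 < X)
  have hX1 : (1 : ℝ) ≤ X := by exact_mod_cast (by omega : 1 ≤ X)
  -- `y ≤ yN ≤ 2y`
  have hyN1 : y ≤ yN := by
    rw [hy, hyN]
    exact Real.log_le_log hX0 (by rw [hNdef]; exact_mod_cast (by omega : X ≤ 4 * X))
  have hyN2 : yN ≤ 2 * y := log_four_mul_le hX4
  have hyN0 : 0 < yN := by linarith only [hy0, hyN1]
  -- `E = exp(yN^{2/3}) ≤ exp(2 y^{2/3})`, the cap `Hp ∈ [E/2, E]`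
  have hE2 : E ≤ Real.exp (2 * y ^ (2 / 3 : ℝ)) := by
    refine Real.exp_le_exp.mpr ?_
    calc yN ^ (2 / 3 : ℝ) ≤ (2 * y) ^ (2 / 3 : ℝ) := Real.rpow_le_rpow hyN0.le hyN2 (by norm_num)
      _ = (2 : ℝ) ^ (2 / 3 : ℝ) * y ^ (2 / 3 : ℝ) := Real.mul_rpow (by norm_num) hy0.le
      _ ≤ 2 * y ^ (2 / 3 : ℝ) := by
          gcongr
          calc (2 : ℝ) ^ (2 / 3 : ℝ) ≤ (2 : ℝ) ^ (1 : ℝ) :=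
                Real.rpow_le_rpow_of_exponent_le (by norm_num) (by norm_num)
            _ = 2 := Real.rpow_one 2
  have hE0 : 0 < E := Real.exp_pos _
  have hHpE : (Hp : ℝ) ≤ E := cap_le N
  have hEHp : E / 2 ≤ Hp := by
    have hfl : E - 1 < (Hp : ℝ) := Nat.sub_one_lt_floor _
    have hE1 : (2 : ℝ) ≤ E := by
      have : (1 : ℝ) ≤ yN ^ (2 / 3 : ℝ) := Real.one_le_rpow (by linarith only [hy1, hyN1]) (by norm_num)
      calc (2 : ℝ) ≤ Real.exp 1 := by linarith [Real.add_one_le_exp (1 : ℝ)]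
        _ ≤ E := Real.exp_le_exp.mpr this
    linarith only [hfl, hE1]
  have hHp1 : 1 ≤ Hp := one_le_cap N
  have hHp0 : (0 : ℝ) < Hp := by exact_mod_cast hHp1
  -- `H`: `Hp ≤ E ≤ H ≤ X`, `H ≥ 1`
  have hEH' : E ≤ H := hE2.trans hEH
  have hHpH : (Hp : ℝ) ≤ H := hHpE.trans hEH'
  have hHpH' : Hp ≤ H := by exact_mod_cast hHpH
  have hH1 : 1 ≤ H := hHp1.trans hHpH'
  have hH1' : (1 : ℝ) ≤ H := by exact_mod_cast hH1
  have hHθ : (H : ℝ) ≤ (X : ℝ) ^ θ := Nat.floor_le (by positivity)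
  have hHX' : (H : ℝ) ≤ X := hHθ.trans (by
    calc (X : ℝ) ^ θ ≤ (X : ℝ) ^ (1 : ℝ) := Real.rpow_le_rpow_of_exponent_le hX1 hθ1.le
      _ = X := Real.rpow_one _)
  have hHX : H ≤ X := by exact_mod_cast hHX'
  -- `J, L`
  have hJ1n : 2 * H < J * Hp := by
    rw [hJdef, add_mul, one_mul]
    exact Nat.lt_div_mul_add (by omega)
  have hJ2 : (J : ℝ) ≤ 2 * H / Hp + 1 := by
    have h1 : ((2 * H / Hp : ℕ) : ℝ) ≤ ((2 * H : ℕ) : ℝ) / (Hp : ℕ) := Nat.cast_div_le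
    rw [hJdef]; push_cast at h1 ⊢
    linarith only [h1]
  have hL2H : 2 * H ≤ L := by rw [hLdef]; exact hJ1n.le
  have hL3H : (L : ℝ) ≤ 3 * H := by
    rw [hLdef]; push_cast
    calc (J : ℝ) * Hp ≤ (2 * H / Hp + 1) * Hp := by gcongr
      _ = 2 * H + Hp := by field_simp
      _ ≤ 3 * H := by linarith only [hHpH]
  have hL1 : 1 ≤ L := by omega
  have hXLN : X + L ≤ N := by
    have : (L : ℝ) ≤ 3 * X := hL3H.trans (by linarith only [hHX'])
    have : L ≤ 3 * X := by exact_mod_cast this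
    omega
  -- Chebyshev and `w`
  have hpi0 : 0 ≤ piX := Nat.cast_nonneg _
  have hXy : (X : ℝ) / y ≤ 2 * piX := by
    rw [div_le_iff₀ hy0]
    rw [div_le_iff₀ (by positivity)] at hπlo
    linarith only [hπlo]
  have hw0 : 0 < w := Real.rpow_pos_of_pos hy0 _
  have hyw2 : 1 / y ≤ w ^ 2 := by
    rw [hw, ← Real.rpow_natCast, ← Real.rpow_mul hy0.le, div_le_iff₀ hy0]
    calc (1 : ℝ) ≤ y ^ ((δ - 1 / 3) * ((2 : ℕ) : ℝ) + 1) :=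
          Real.one_le_rpow hy1 (by push_cast; linarith only [hδ0])
      _ = y ^ ((δ - 1 / 3) * ((2 : ℕ) : ℝ)) * y := by rw [Real.rpow_add hy0, Real.rpow_one]
  ---------------------------------------------------------------
  -- Fourier side: `main_inequality`
  have hTX' : ∀ α : ℝ, ∑ k ∈ Icc 1 N, ‖moebiusTwistedSum ((Icc k (k + Hp - 1)).filter
      (lichtmanTypicalWith 100 (N : ℝ) 10 δ' (Hp : ℝ))) α‖ ≤ C22' * Hp * (4 * X) / y ^ 2 := by
    intro α
    refine (hTX α).trans ?_
    have hN : ((N : ℕ) : ℝ) = 4 * X := by rw [hNdef]; push_cast; ring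
    have h105 : yN ^ ((10 : ℝ) / 5) = yN ^ 2 := by
      rw [show (10 : ℝ) / 5 = (2 : ℕ) by norm_num, Real.rpow_natCast]
    rw [h105, hN]
    have hy2 : y ^ 2 ≤ yN ^ 2 := by gcongr
    calc C22 * ((Hp : ℝ) * (4 * X) / yN ^ 2) ≤ C22' * ((Hp : ℝ) * (4 * X) / yN ^ 2) :=
          mul_le_mul_of_nonneg_right (le_max_left _ _) (by positivity)
      _ ≤ C22' * ((Hp : ℝ) * (4 * X) / y ^ 2) := by gcongr
      _ = _ := by ring
  have hmain := main_inequality X H Hp J L N hHp1 rfl hL2H hL1 hXLN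
    (lichtmanTypicalWith 100 (N : ℝ) 10 δ' (Hp : ℝ)) _ hTX'
  rw [← hpiX] at hmain
  -- `J T + L Hp ≤ (12 C22' + 3) H X / y²`
  have hJT : (J : ℝ) * (C22' * Hp * (4 * X) / y ^ 2) + L * Hp ≤ (12 * C22' + 3) * H * X / y ^ 2 := by
    have e1 : (J : ℝ) * (C22' * Hp * (4 * X) / y ^ 2) ≤ 12 * C22' * H * X / y ^ 2 := by
      calc (J : ℝ) * (C22' * Hp * (4 * X) / y ^ 2) ≤ (2 * H / Hp + 1) * (C22' * Hp * (4 * X) / y ^ 2) := by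
            gcongr
        _ = C22' * (2 * H + Hp) * (4 * X) / y ^ 2 := by field_simp
        _ ≤ C22' * (3 * H) * (4 * X) / y ^ 2 := by gcongr; linarith only [hHpH]
        _ = 12 * C22' * H * X / y ^ 2 := by ring
    have e2 : (L : ℝ) * Hp ≤ 3 * H * X / y ^ 2 := by
      calc (L : ℝ) * Hp ≤ (3 * H) * E := by gcongr
        _ ≤ (3 * H) * (X / y ^ 2) := by gcongr; exact hE2.trans hEX
        _ = 3 * H * X / y ^ 2 := by ring
    have e3 : (12 * C22' + 3) * (H : ℝ) * X / y ^ 2 = 12 * C22' * H * X / y ^ 2 + 3 * H * X / y ^ 2 := by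
      ring
    rw [e3]; exact add_le_add e1 e2
  have hQ : 4 * (H : ℝ) * piX * ((J : ℝ) * (C22' * Hp * (4 * X) / y ^ 2) + L * Hp) ≤
      (cF * H * piX * w) ^ 2 := by
    calc 4 * (H : ℝ) * piX * ((J : ℝ) * (C22' * Hp * (4 * X) / y ^ 2) + L * Hp)
        ≤ 4 * H * piX * ((12 * C22' + 3) * H * X / y ^ 2) := by gcongr
      _ = 4 * (12 * C22' + 3) * H ^ 2 * (piX * (X / y)) * (1 / y) := by ring
      _ ≤ 4 * (12 * C22' + 3) * H ^ 2 * (piX * (2 * piX)) * w ^ 2 := by gcongr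
      _ = (cF * H * piX * w) ^ 2 := by
          rw [mul_pow, mul_pow, mul_pow, hcF, Real.sq_sqrt (by positivity)]; ring
  have hFmain : Real.sqrt (4 * (H : ℝ) * piX * ((J : ℝ) * (C22' * Hp * (4 * X) / y ^ 2) + L * Hp)) ≤
      cF * H * piX * w := by
    refine (Real.sqrt_le_sqrt hQ).trans ?_
    rw [Real.sqrt_sq (by positivity)]
  ---------------------------------------------------------------
  -- sieve side
  have hsv' : ∀ h : ℕ, 1 ≤ h → h ≤ X → ∀ P Q : ℝ, Real.log X ≤ P → P ≤ Q →
      Q ≤ Real.exp (Real.log X / (40 * Real.log (Real.log X))) →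
      (#{p ∈ Nat.primesLE X | ¬ HasPrimeFactorIn P Q (p + h)} : ℝ) ≤
        Cs' * (X * Real.log (Real.log X) / Real.log X) * (Real.log P / Real.log Q) := by
    intro h hh hhX P Q hP hPQ hQ
    have h0 := hCs X hX₀ h hh hhX P Q hP hPQ hQ
    have h0' : (#{p ∈ Nat.primesLE X | ¬ HasPrimeFactorIn P Q (p + h)} : ℝ) ≤
        Cs * (X * Real.log (Real.log X) / Real.log X) * (Real.log P / Real.log Q) := by
      unfold HasPrimeFactorIn
      convert h0 using 4
    refine h0'.trans ?_
    have hP1 : 1 ≤ P := hy1.trans hP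
    have hrat : 0 ≤ Real.log P / Real.log Q :=
      div_nonneg (Real.log_nonneg hP1) (Real.log_nonneg (hP1.trans hPQ))
    exact mul_le_mul_of_nonneg_right (mul_le_mul_of_nonneg_right (le_max_left _ _)
      (by positivity)) hrat
  have n3 : 1040 * Real.log yN ≤ yN ^ (2 / 3 : ℝ) - Real.log 2 := by
    rw [hyN, hNdef]; linarith only [n3a, n3b]
  have hsplit23 : y = y ^ (2 / 3 : ℝ) * y ^ (1 / 3 : ℝ) := by
    rw [← Real.rpow_add hy0]; norm_num
  have nQ1' : yN ^ (2 / 3 : ℝ) ≤ y / (40 * ll) := by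
    -- `yN^{2/3} ≤ 2 y^{2/3}` and `80 ll y^{2/3} ≤ y`
    have h1 : yN ^ (2 / 3 : ℝ) ≤ 2 * y ^ (2 / 3 : ℝ) := by
      have := hE2; rwa [hEdef, Real.exp_le_exp] at this
    rw [le_div_iff₀ (by positivity)]
    have h13 : 80 * ll ≤ y ^ (1 / 3 : ℝ) := by linarith only [nQ1]
    have hpos : 0 ≤ y ^ (2 / 3 : ℝ) := Real.rpow_nonneg hy0.le _
    calc yN ^ (2 / 3 : ℝ) * (40 * ll) ≤ 2 * y ^ (2 / 3 : ℝ) * (40 * ll) := by gcongr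
      _ = y ^ (2 / 3 : ℝ) * (80 * ll) := by ring
      _ ≤ y ^ (2 / 3 : ℝ) * y ^ (1 / 3 : ℝ) := mul_le_mul_of_nonneg_left h13 hpos
      _ = y := hsplit23.symm
  have nQ2' : yN ^ (1 - δ' / 2) ≤ y / (40 * ll) := by
    have h1 : yN ^ (1 - δ' / 2) ≤ 2 * y ^ (1 - δ' / 2) := by
      calc yN ^ (1 - δ' / 2) ≤ (2 * y) ^ (1 - δ' / 2) :=
            Real.rpow_le_rpow hyN0.le hyN2 (by linarith only [hδ'3])
        _ = (2 : ℝ) ^ (1 - δ' / 2) * y ^ (1 - δ' / 2) := Real.mul_rpow (by norm_num) hy0.le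
        _ ≤ 2 * y ^ (1 - δ' / 2) := by
            gcongr
            calc (2 : ℝ) ^ (1 - δ' / 2) ≤ (2 : ℝ) ^ (1 : ℝ) :=
                  Real.rpow_le_rpow_of_exponent_le (by norm_num) (by linarith only [hδ'0])
              _ = 2 := Real.rpow_one 2
    have hsplitδ : y = y ^ (1 - δ' / 2) * y ^ (δ' / 2) := by
      rw [← Real.rpow_add hy0]; ring_nf; exact (Real.rpow_one y).symm
    have h13 : 80 * ll ≤ y ^ (δ' / 2) := by rw [hδ']; linarith only [nQ2]
    have hpos : 0 ≤ y ^ (1 - δ' / 2) := Real.rpow_nonneg hy0.le _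
    rw [le_div_iff₀ (by positivity)]
    calc yN ^ (1 - δ' / 2) * (40 * ll) ≤ 2 * y ^ (1 - δ' / 2) * (40 * ll) := by gcongr
      _ = y ^ (1 - δ' / 2) * (80 * ll) := by ring
      _ ≤ y ^ (1 - δ' / 2) * y ^ (δ' / 2) := mul_le_mul_of_nonneg_left h13 hpos
      _ = y := hsplitδ.symm
  have n6' : Real.log yN ≤ yN ^ (2 / 3 + δ' / 2) := by
    rw [hyN, hNdef, hδ']; linarith only [n6]
  have hExc := sum_card_exceptional_le_with (X := X) (H := H) (N := N) (Hp := (Hp : ℝ)) hCs'0 hδ'0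
    hδ'3 hHX hy1 hll1 hyN1 hyN2 n3 nQ1' nQ2' n6' hEHp hHpE
    (lichtmanTypicalWith 100 (N : ℝ) 10 δ' (Hp : ℝ)) (fun n => Iff.rfl) hsv'
  rw [← hy, ← hll] at hExc
  -- simplify the sieve bound to `2 Cs' H π w`
  have hS1 : Cs' * (X * ll / y) * (4000 * ll / y ^ (2 / 3 : ℝ)) ≤ Cs' * piX * w := by
    have ht : y ^ ((1 / 3 + δ) / 2) * y ^ ((1 / 3 + δ) / 2) = y ^ (2 / 3 : ℝ) * w := by
      rw [hw, ← Real.rpow_add hy0, ← Real.rpow_add hy0]; congr 1; ring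
    set t := y ^ ((1 / 3 + δ) / 2) with htdef
    have h52 : ll * ll ≤ (1 / 90 * t) * (1 / 90 * t) := mul_le_mul n9 n9 hll0.le (by positivity)
    have h52' : (1 / 90 * t) * (1 / 90 * t) = t * t / 8100 := by ring
    have hll2 : 0 ≤ ll * ll := by positivity
    have hsq : 8000 * (ll * ll) ≤ y ^ (2 / 3 : ℝ) * w := by
      rw [← ht]; linarith only [h52, h52', hll2]
    have hy23 : 0 < y ^ (2 / 3 : ℝ) := Real.rpow_pos_of_pos hy0 _
    have hmid : 4000 * (ll * ll) / y ^ (2 / 3 : ℝ) ≤ w / 2 := by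
      rw [div_le_iff₀ hy23]; linarith only [hsq]
    calc Cs' * (X * ll / y) * (4000 * ll / y ^ (2 / 3 : ℝ))
        = Cs' * (X / y) * (4000 * (ll * ll) / y ^ (2 / 3 : ℝ)) := by ring
      _ ≤ Cs' * (2 * piX) * (w / 2) := by gcongr
      _ = Cs' * piX * w := by ring
  have hS2 : Cs' * (X * ll / y) * y ^ (δ' - 1 / 3) ≤ Cs' * piX * w := by
    have hllw : ll * y ^ (δ' - 1 / 3) ≤ w / 2 := by
      calc ll * y ^ (δ' - 1 / 3) ≤ (1 / 2 * y ^ (δ / 2)) * y ^ (δ' - 1 / 3) := by gcongr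
        _ = w / 2 := by
            rw [hw, hδ', mul_assoc, ← Real.rpow_add hy0,
              show δ / 2 + (δ / 2 - 1 / 3) = δ - 1 / 3 by ring]
            ring
    calc Cs' * (X * ll / y) * y ^ (δ' - 1 / 3) = Cs' * (X / y) * (ll * y ^ (δ' - 1 / 3)) := by
          ring
      _ ≤ Cs' * (2 * piX) * (w / 2) := by gcongr
      _ = Cs' * piX * w := by ring
  have hS1' : (H : ℝ) * (Cs' * (X * ll / y) * (4000 * ll / y ^ (2 / 3 : ℝ))) ≤ H * (Cs' * piX * w) :=
    mul_le_mul_of_nonneg_left hS1 (by positivity)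
  have hS2' : (H : ℝ) * (Cs' * (X * ll / y) * y ^ (δ' - 1 / 3)) ≤ H * (Cs' * piX * w) :=
    mul_le_mul_of_nonneg_left hS2 (by positivity)
  ---------------------------------------------------------------
  -- total
  have htot : ∑ h ∈ Icc 1 H, |moebiusShiftedPrimeSum h X| ≤ (cF + 2 * Cs') * (H * piX * w) := by
    have h1 : (H : ℝ) * (Cs' * (X * ll / y) * (4000 * ll / y ^ (2 / 3 : ℝ)) +
        Cs' * (X * ll / y) * y ^ (δ' - 1 / 3)) ≤ 2 * Cs' * (H * piX * w) := by
      rw [mul_add]; linarith only [hS1', hS2']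
    calc ∑ h ∈ Icc 1 H, |moebiusShiftedPrimeSum h X| ≤ _ := hmain
      _ ≤ cF * H * piX * w + 2 * Cs' * (H * piX * w) := add_le_add hFmain (hExc.trans h1)
      _ = (cF + 2 * Cs') * (H * piX * w) := by ring
  -- rewrite the claimed bound
  have hrhs : (H : ℝ) * piX / y ^ (1 / 3 - δ) = H * piX * w := by
    rw [hw, show δ - 1 / 3 = -(1 / 3 - δ) by ring, Real.rpow_neg hy0.le, div_eq_mul_inv]
  rw [Real.norm_of_nonneg (Finset.sum_nonneg fun _ _ => abs_nonneg _), Real.norm_of_nonneg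
    (by positivity), hrhs]
  exact htot

end Literature.NumberTheory.Sieve
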